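import Literature.MathematicalPhysics.QuantumFieldTheory.Balaban1985CMP102.SectBRestricted

/-!
# Bałaban CMP 102 (1985) 255–275, AS-PRINTED SPINE — `SectBThreshold`: the two small-field domains of (4)/(40) (FIELD
# plaquettes) and of (47) (MINIMIZER plaquettes) — the inclusions between them DERIVED, modulo explicit constant
# inequalities, from the two printed regularity statements they rest on ([7] Thm 1 (8) p. 279; [4] Prop 2 (54) p. 26) read
# on the CMP 102 objects as hypothesis-shaped `Prop`s; the MATCHED field threshold `δ′_k = g_kp(g_k)/B₃` at which the
# restricted sandwich of `SectBRestricted` holds on the whole small-field domain — an ADDENDUM file (siblings byte-stable;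
# dot-notation extensions of `SectB.TowerObjects` declared from this file of the same directory)

Source: T. Bałaban, *Ultraviolet stability of three-dimensional lattice pure gauge field theories*, Commun. Math. Phys.
**102** (1985) 255–275 [Balaban1985UV3] ([B10]; PDF page = journal page − 254; locators as in `Setting.lean`/`SectB.lean`);
[7] = T. Bałaban, *The variational problem and background fields in renormalization group method for lattice gauge
theories*, Commun. Math. Phys. **102** (1985) 277–309 [Balaban1985Variational]; [4] = T. Bałaban, *Averaging operations for
lattice gauge theories*, Commun. Math. Phys. **98** (1985) 17–51 [Balaban1985Averaging].

WHAT [B10] PRINTS — two thresholds that it never relates (lane pub-balaban GAPS G-pv15-1; this directory's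
`SectBLowerBound` types the two inclusions `Chi4SubChi47` / `Chi47SubChi4` as bare hypotheses, the cell ym3-torus's LATENT
row G3D-09 = node N5thr): (4) p. 256 L24–27 «|U(∂p) − 1| < ε₁, p ⊂ T₁^{(K)}» with (7) p. 257 L33–35 / p. 267 L35–37 «ε₁ =
g_kp(g_k)» (the FIELD's plaquettes; `RunObjects.chi`, `Setup.PlaqSmall (ε₁ k)`), versus (47) p. 267 L19–20 «the
characteristic function χ_k corresponds to the restrictions on V given by the conditions |U_k(∂p) − 1| < g_kp(g_k)η², p ⊂
T_η» (the MINIMIZER's plaquettes; `SectB.TowerObjects.Chi47Restriction`).  WHAT THE CITED PAPERS PRINT: [7] Thm 1 p. 279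
«There exist positive constants a₀, a₁, B₃, B₄(β₀), M(ε₁), B₃a₁ ≤ a₀, such that for an arbitrary configuration V satisfying
(7) with ε₁ ≤ a₁ there exists a minimal orbit in the space 𝔘_k({Ω_j}, B₃ε₁) ∩ 𝔅_k(𝔅_k, V). (8) … The constants a₀, a₁, B₃
depend on d and L only» with [7] (2) p. 278 «|U(∂p) − 1| < ε₀L^{−2j} = ε₀η²(L^jη)^{−2} for p ∈ Ω_j» (no large fields: every
`Ω_j = T`, so `𝔘_k(B₃ε₁)` = «all plaquettes of `U` on `T_η` are `B₃ε₁η²`-small») and (7) p. 278 «|V(∂p) − 1| < ε₁» — typed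
AS PRINTED over its own carriers in LQB `B11.Thm1Printed`; [4] Prop 2 (54) p. 26 «|Ū^k(∂p) − 1| < α₀ + 2C₀α₀² < 2α₀» from
«|U(∂p) − 1| < α₀η²» (LQB `B7.Prop2Printed`), quoted by [7] p. 278 (after (7)): «if the space (6) is non-empty and ε₀ is
sufficiently small, then by Proposition 2 [4] the configuration V satisfies (7) with ε₁ = O(ε₀).»

WHAT THIS FILE ADDS (cell `ym3-torus`, seat p1 gen 2, task P1-6 of TARGET.md v2 «TYPE the matched-threshold object: `hincl`
at King-type field thresholds δ′_k := g_kp(g_k)/B₃ from [B11] Thm 1 (8)»; serves nodes N5thr/N6a).  Nothing of the siblings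
changes; nothing of the papers is asserted — the two regularity statements enter as hypothesis-shaped `Prop`s READ ON THE
CMP 102 OBJECTS (the binder `UkH` of (42) at the trivial history, the averaging `av` of (2)), and what is PROVED is the
bookkeeping from them to the inclusions:
§1 `MinimizerIncl8 W a₁ B₃ k` = [7] Thm 1 (8) at the history without large fields, as the inclusion it yields («ε₁-small
   field ⇒ B₃ε₁η²-small minimizer», `0 < ε₁ ≤ a₁`); `chi4SubChi47_of_incl8`: the latent inclusion `SectBLowerBound.Chi4SubChi47`
   («(4)-domain ⊆ (47)-domain») FOLLOWS from it and the constant inequality `B₃·ε₁ k ≤ g_kp(g_k)` (with `0 < ε₁ k ≤ a₁`) —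
   G3D-09's first direction is «[7] Thm 1 (8) + a constants-only condition [B10] never states» (at print's `ε₁ = g_kp(g_k)`
   it reads `B₃ ≤ 1`).
§2 `AveragingIncl54 W a k` = [4] Prop 2 (54) for the `k`-fold averaging («α₀η²-small fine field ⇒ 2α₀-small averaged
   field», `0 < α₀ ≤ a`); `chi47SubChi4_of_incl54`: the converse latent inclusion `SectBLowerBound.Chi47SubChi4` FOLLOWS from
   it, the constraint «`Ū^k(U_k(V)) = V`» of (42) (a display about the binder `UkH`; `RunObjects.IsMinimalConfig` records it
   only on the (4)-domain) and `2·g_kp(g_k) ≤ ε₁ k` (with `g_kp(g_k) ≤ a`) — at print's `ε₁ = g_kp(g_k)` it reads `2 ≤ 1`: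
   the converse direction is NOT available at equal thresholds from (54) as printed (factor 2), which is why the tree's
   `Ineq47AsPrinted` (factor `χ` of (4)) and print's (47) (factor `χ_k`) are kept apart (`SectBLowerBound`).
§3 THE MATCHED FIELD THRESHOLD `deltaMatched W B₃ k = g_kp(g_k)/B₃` (the field threshold at which [7] Thm 1 (8) delivers
   exactly (47)'s minimizer threshold; the device of matching thresholds is King's, CMP 102 (1986) 649, App. p. 676, for the
   abelian Higgs model — here only the arithmetic): `incl_deltaMatched` — under `MinimizerIncl8`, every `δ′_k`-small field
   has a (47)-small minimizer (the hypothesis `hincl` of `SectBRestricted.sandwich_of_inclusion`); `sandwich_matched` — hence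
   the restricted two-sided sandwich of (41)/(47) holds on the WHOLE `δ′_k`-small domain for any threshold profile `δ` with
   `δ k = δ′_k`: N6a's inputs become {`Ineq41Restricted`, `Ineq47Restricted`, `MinimizerIncl8` + `0 < δ′_k ≤ a₁`}.  WHAT THE
   MATCHED THRESHOLD COSTS ELSEWHERE (recorded, not typed here): the large-field decomposition (38)–(40) must then be run at
   `δ′_j = g_jp(g_j)/B₃` instead of (40)'s `2L²g_{j−1}p(g_{j−1})`, so the per-plaquette small factor of (7)/(67)–(71) becomes
   `exp(−O(1)p(g_j)²/B₃²)` — the same shape with `b₀ ↦ b₀/B₃`, absorbed by print's «b₀ is a sufficiently large absolute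
   constant» (p. 257 L35), i.e. by the lane's choice of `b₀` in `Primitives`.
-/

namespace Literature.MathematicalPhysics.QuantumFieldTheory.Balaban1985CMP102.SectB.TowerObjects

open Literature.MathematicalPhysics.QuantumFieldTheory.Balaban1983to89
open Literature.MathematicalPhysics.QuantumFieldTheory.Balaban1985CMP102.Setting

variable {L : ℕ} {S : Scales L} {G : Type} [Balaban1983to89.GaugeGroup G] [MeasurableSpace G]
  [Balaban1983to89.HaarData G] (W : TowerObjects S G)

/-! ## §0 Plumbing: monotonicity of the small-field condition in the threshold -/

omit [MeasurableSpace G] [Balaban1983to89.HaarData G] in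
/-- `PlaqSmall` is monotone in the threshold. Plumbing. [folklore] -/
private theorem plaqSmall_mono {j : ℕ} {δ δ' : ℝ} (h : δ ≤ δ') (U : Balaban1983to89.GaugeField S.P j G)
    (hU : Balaban1983to89.PlaqSmall δ U) : Balaban1983to89.PlaqSmall δ' U :=
  fun p => (hU p).trans_le h

/-- `p(g_k)·g_k`-type abbreviation: the printed threshold `g_kp(g_k)` of (7) p. 257 L34 / p. 267 L36 at step `k`
(`Scales.gk`, `B10.pFun b₀ p₀`). [cite: Balaban1985UV3, (7) p.257 + p.267 L35–37] -/
noncomputable def gkp (k : ℕ) : ℝ :=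
  S.gk k * Balaban1983to89.B10.pFun W.b₀ W.p₀ (S.gk k)

/-- `Chi47Restriction k V` unfolded with `gkp`: all plaquettes of the minimizer `U_k(V)` are `g_kp(g_k)η²`-small.
Definitional. [cite: Balaban1985UV3, (47) p.267] -/
theorem chi47Restriction_iff (k : ℕ) (V : Balaban1983to89.GaugeField S.P k G) :
    W.Chi47Restriction k V ↔ Balaban1983to89.PlaqSmall (W.gkp k * S.eta k ^ 2) (W.UkH k (W.triv k) V) :=
  Iff.rfl

/-! ## §1 [7] Thm 1 (8) at the history without large fields, and G3D-09's first direction from it -/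

/-- **[7] Thm 1 (8) AT THE HISTORY WITHOUT LARGE FIELDS, as the inclusion it yields, read on the CMP 102 objects**
(hypothesis-shaped; never asserted): [Balaban1985Variational] Thm 1 p. 279 «for an arbitrary configuration V satisfying (7)
with ε₁ ≤ a₁ there exists a minimal orbit in the space 𝔘_k({Ω_j}, B₃ε₁) ∩ 𝔅_k(𝔅_k, V). (8)», with (2) p. 278 (all `Ω_j = T`:
«|U(∂p) − 1| < ε₀η²» on `T_η` at `ε₀ = B₃ε₁`) and (7) p. 278 «|V(∂p) − 1| < ε₁»: for every `0 < ε₁ ≤ a₁` and every `V` on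
`T₁^{(k)}` with all plaquette variables `ε₁`-small, the minimizer of (42) at the trivial history (`UkH k (triv k) V` =
«the minimal configuration … determined by the configuration U on T₁^{(k)}» of (5) p. 256, by `UkH_triv`) has all plaquette
variables `B₃ε₁η²`-small, `η = L^{−k}` (`Scales.eta`).  «The constants a₀, a₁, B₃ depend on d and L only.»  (LQB
`B11.Thm1Printed` types the theorem over [7]'s own carriers; this is its clause (8) on the binder `UkH`.)
[cite: Balaban1985Variational, Thm 1 (8) p.279 + (2), (7) p.278] -/
def MinimizerIncl8 (a₁ B₃ : ℝ) (k : ℕ) : Prop :=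
  ∀ ε₁ : ℝ, 0 < ε₁ → ε₁ ≤ a₁ → ∀ V : Balaban1983to89.GaugeField S.P k G, Balaban1983to89.PlaqSmall ε₁ V →
    Balaban1983to89.PlaqSmall (B₃ * ε₁ * S.eta k ^ 2) (W.UkH k (W.triv k) V)

/-- **G3D-09, direction «(4)-domain ⊆ (47)-domain», FROM [7] Thm 1 (8) AND A CONSTANTS-ONLY CONDITION**: if the minimizer
inclusion (8) holds with constants `a₁, B₃`, the run's threshold `ε₁ k` of (4) satisfies `0 < ε₁ k ≤ a₁`, and
`B₃·ε₁ k ≤ g_kp(g_k)`, then every `V` in the (4)-domain has a (47)-small minimizer (`SectBLowerBound.Chi4SubChi47 W k`).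
At print's choice `ε₁ = g_kp(g_k)` (p. 267 L36) the condition reads `B₃ ≤ 1` — not stated in [B10] ([7]: `B₃` depends on
`d, L` only).  Bookkeeping over the hypothesis. [cite: Balaban1985UV3, (4) p.256 + (47) p.267; Balaban1985Variational, Thm 1 (8) p.279] -/
theorem chi4SubChi47_of_incl8 {a₁ B₃ : ℝ} (k : ℕ) (h8 : W.MinimizerIncl8 a₁ B₃ k) (hpos : 0 < W.ε₁ k)
    (ha : W.ε₁ k ≤ a₁) (hB : B₃ * W.ε₁ k ≤ W.gkp k) : W.Chi4SubChi47 k := by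
  intro V hV
  rw [chi47Restriction_iff]
  exact plaqSmall_mono (mul_le_mul_of_nonneg_right hB (sq_nonneg _)) _ (h8 (W.ε₁ k) hpos ha V hV)

/-! ## §2 [4] Prop 2 (54) for the `k`-fold averaging, and G3D-09's converse direction from it -/

/-- **[4] Prop 2 (54) FOR THE `k`-FOLD AVERAGING OF (2), read on the CMP 102 objects** (hypothesis-shaped; never
asserted): [Balaban1985Averaging] Prop 2 (54) p. 26 «|Ū^k(∂p) − 1| < α₀ + 2C₀α₀² < 2α₀» for fine configurations with
«|U(∂p) − 1| < α₀η²» (LQB `B7.Prop2Printed`), for `0 < α₀ ≤ a` (`a` = the printed smallness of `α₀`): every `α₀η²`-small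
configuration on `T_η` has a `2α₀`-small `k`-fold average `Ū^k = Averaging.iter av k` (`av` = the averaging of (2),
`RunObjects.av`). [cite: Balaban1985Averaging, Prop 2 (54) p.26] -/
def AveragingIncl54 (a : ℝ) (k : ℕ) : Prop :=
  ∀ α₀ : ℝ, 0 < α₀ → α₀ ≤ a → ∀ U : Balaban1983to89.GaugeField S.P 0 G,
    Balaban1983to89.PlaqSmall (α₀ * S.eta k ^ 2) U →
      Balaban1983to89.PlaqSmall (2 * α₀) (Balaban1983to89.Averaging.iter W.av k U)

/-- **G3D-09, converse direction «(47)-domain ⊆ (4)-domain», FROM [4] Prop 2 (54), THE CONSTRAINT OF (42) AND A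
CONSTANTS-ONLY CONDITION**: if (54) holds for the `k`-fold averaging with smallness `a`, the minimizer of the trivial
history satisfies its constraint «`Ū^k = V` on `T₁^{(k)}`» ((42) p. 266 with `Λ_k = T`; a display about the binder `UkH` —
`RunObjects.IsMinimalConfig` records it only on the (4)-domain, so it is a hypothesis here), `0 < g_kp(g_k) ≤ a` and
`2·g_kp(g_k) ≤ ε₁ k`, then every `V` with a (47)-small minimizer lies in the (4)-domain (`SectBLowerBound.Chi47SubChi4 W k`).
At print's `ε₁ = g_kp(g_k)` the condition reads `2 ≤ 1`: (54) as printed does NOT give the converse inclusion at equal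
thresholds (factor 2) — the reason the tree keeps `Ineq47AsPrinted` (factor `χ` of (4)) and print's (47) (factor `χ_k`)
apart.  Bookkeeping over the hypotheses. [cite: Balaban1985UV3, (42) p.266 + (47) p.267; Balaban1985Averaging, Prop 2 (54) p.26] -/
theorem chi47SubChi4_of_incl54 {a : ℝ} (k : ℕ) (h54 : W.AveragingIncl54 a k)
    (hcons : ∀ V : Balaban1983to89.GaugeField S.P k G,
      Balaban1983to89.Averaging.iter W.av k (W.UkH k (W.triv k) V) = V)
    (hpos : 0 < W.gkp k) (ha : W.gkp k ≤ a) (hε : 2 * W.gkp k ≤ W.ε₁ k) : W.Chi47SubChi4 k := by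
  intro V hV
  rw [chi47Restriction_iff] at hV
  have h := h54 (W.gkp k) hpos ha (W.UkH k (W.triv k) V) hV
  rw [hcons V] at h
  exact plaqSmall_mono hε V h

/-! ## §3 The matched field threshold `δ′_k = g_kp(g_k)/B₃` and the restricted sandwich on the whole small-field domain -/

/-- **THE MATCHED FIELD THRESHOLD** `δ′_k := g_kp(g_k)/B₃`: the field threshold at which [7] Thm 1 (8) (`MinimizerIncl8`,
constant `B₃`) delivers exactly (47)'s minimizer threshold `g_kp(g_k)η²` (p. 267 L19–20).  The device of MATCHING the
field-side and minimizer-side thresholds is King's (CMP 102 (1986) 649, Appendix p. 676, abelian Higgs model); only the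
arithmetic is typed here. [cite: Balaban1985UV3, (47) p.267; Balaban1985Variational, Thm 1 (8) p.279] -/
noncomputable def deltaMatched (B₃ : ℝ) (k : ℕ) : ℝ :=
  W.gkp k / B₃

/-- `B₃·δ′_k = g_kp(g_k)` for `B₃ > 0`. Arithmetic. [cite: Balaban1985UV3, (47) p.267] -/
theorem B₃_mul_deltaMatched {B₃ : ℝ} (hB : 0 < B₃) (k : ℕ) : B₃ * W.deltaMatched B₃ k = W.gkp k := by
  unfold deltaMatched
  field_simp

/-- **AT THE MATCHED THRESHOLD THE INCLUSION HOLDS**: under `MinimizerIncl8 W a₁ B₃ k` with `B₃ > 0` and `0 < δ′_k ≤ a₁`,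
every `δ′_k`-small field `V` has a (47)-small minimizer — the hypothesis `hincl` of `SectBRestricted.sandwich_of_inclusion` at
the profile value `δ′_k`.  Bookkeeping. [cite: Balaban1985UV3, (47) p.267; Balaban1985Variational, Thm 1 (8) p.279] -/
theorem incl_deltaMatched {a₁ B₃ : ℝ} (k : ℕ) (h8 : W.MinimizerIncl8 a₁ B₃ k) (hB : 0 < B₃)
    (hpos : 0 < W.deltaMatched B₃ k) (ha : W.deltaMatched B₃ k ≤ a₁) (V : Balaban1983to89.GaugeField S.P k G)
    (hV : Balaban1983to89.PlaqSmall (W.deltaMatched B₃ k) V) : W.Chi47Restriction k V := by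
  rw [chi47Restriction_iff, ← W.B₃_mul_deltaMatched hB k]
  exact h8 _ hpos ha V hV

/-- `δ′_k > 0` as soon as `B₃ > 0`, `g_k > 0` and `p(g_k) > 0` (e.g. `b₀ > 0`, `g_k ≤ 1`). Arithmetic. [cite: Balaban1985UV3, (7) p.257] -/
theorem deltaMatched_pos {B₃ : ℝ} (hB : 0 < B₃) (k : ℕ) (hg : 0 < S.gk k)
    (hp : 0 < Balaban1983to89.B10.pFun W.b₀ W.p₀ (S.gk k)) : 0 < W.deltaMatched B₃ k := by
  unfold deltaMatched gkp
  positivity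

/-- **N6a AT MATCHED THRESHOLDS — the restricted sandwich on the WHOLE small-field domain**: for any threshold profile `δ`
whose step-`k` value is the matched threshold (`δ k = δ′_k`), the restricted readings of (41)/(47) (`Ineq41Restricted`,
`Ineq47Restricted`) and [7] Thm 1 (8) (`MinimizerIncl8`, with `B₃ > 0`, `0 < δ′_k ≤ a₁`) give, for EVERY `δ′_k`-small `V`,
`e^{−E_k − Rm_k}·e^{F(V)} ≤ ρ^res_k(V) ≤ e^{−E_k + Rm_k}·e^{F(V)}` (`F = explicitExpo`) — N6a's inputs are then
{`Ineq41Restricted`, `Ineq47Restricted`, `MinimizerIncl8` + two constant conditions}, with no separate G3D-09 hypothesis.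
Bookkeeping (`SectBRestricted.sandwich_of_inclusion` + `incl_deltaMatched`). [cite: Balaban1985UV3, (41) p.266 + (47) p.267; Balaban1985Variational, Thm 1 (8) p.279] -/
theorem sandwich_matched {a₁ B₃ : ℝ} (δ : ℕ → ℝ) (k : ℕ) (hδ : δ k = W.deltaMatched B₃ k)
    (h41 : W.Ineq41Restricted δ k) (h47 : W.Ineq47Restricted δ k) (h8 : W.MinimizerIncl8 a₁ B₃ k) (hB : 0 < B₃)
    (hpos : 0 < W.deltaMatched B₃ k) (ha : W.deltaMatched B₃ k ≤ a₁) (V : Balaban1983to89.GaugeField S.P k G)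
    (hV : Balaban1983to89.PlaqSmall (δ k) V) :
    Real.exp (-W.Ecst k - W.Rm k) * Real.exp (W.explicitExpo k V) ≤ W.rhoRes δ k V ∧
      W.rhoRes δ k V ≤ Real.exp (-W.Ecst k + W.Rm k) * Real.exp (W.explicitExpo k V) :=
  W.sandwich_of_inclusion δ k h41 h47 (fun V' hV' => W.incl_deltaMatched k h8 hB hpos ha V' (hδ ▸ hV')) V hV

/-- **… and at a general profile below the matched threshold**: if `δ k ≤ δ′_k` (a SMALLER good event), the inclusion —
hence the sandwich on the whole `δ_k`-small domain — still follows from `MinimizerIncl8` (monotonicity of the small-field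
condition in the threshold); above `δ′_k` (e.g. print's (40) value `2L²g_{k−1}p(g_{k−1})`, `delta40`) it does not.
Bookkeeping. [cite: Balaban1985UV3, (40) p.266 + (47) p.267; Balaban1985Variational, Thm 1 (8) p.279] -/
theorem incl_of_le_deltaMatched {a₁ B₃ : ℝ} (δ : ℕ → ℝ) (k : ℕ) (hle : δ k ≤ W.deltaMatched B₃ k)
    (h8 : W.MinimizerIncl8 a₁ B₃ k) (hB : 0 < B₃) (hpos : 0 < W.deltaMatched B₃ k) (ha : W.deltaMatched B₃ k ≤ a₁)
    (V : Balaban1983to89.GaugeField S.P k G) (hV : Balaban1983to89.PlaqSmall (δ k) V) : W.Chi47Restriction k V :=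
  W.incl_deltaMatched k h8 hB hpos ha V (plaqSmall_mono hle V hV)

end Literature.MathematicalPhysics.QuantumFieldTheory.Balaban1985CMP102.SectB.TowerObjects
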